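import Summits.AtomisticToContinuum.BoseEinsteinCondensation.Theses.BECConjugateDomination
import Literature.MathematicalPhysics.QuantumManyBody.LeeNoBindingCell
import Literature.MathematicalPhysics.QuantumManyBody.LeeNoBindingCellFibre
import Literature.MathematicalPhysics.QuantumManyBody.LeeNoBindingTorus

/-!
# Route `BECConjugateDomination`, crux `PuffFloor` (stmt-AtomisticToContinuum-11785),
# line `coupling-slope-pocket`, stub S2: no binding from classical stability (Lee 2009, Thm. 7)

Supports (does not close) stmt-AtomisticToContinuum-11785. For a smooth-class pair profile `v`
(repulsive finite range `R₀`, finite, `C²` as `ṽ(x) = v(|x|)`, positive soft core `v(0) > 0`)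
and the Puff weight profile `W(r) = r²‖D²ṽ(r e₀)‖`: if `v - t₁W` is classically stable
(`t₁ ∑_{i<j} W ≤ ∑_{i<j} v + BN` on every configuration of `ℝ³`; the conclusion of stub S1),
then there are `t₀ > 0`, `L₀ > 0` such that on EVERY torus of side `L ≥ L₀` and for EVERY
particle number, `t₀ ⟨Ψ, ∑_{i<j} W^per(xᵢ-xⱼ) Ψ⟩ ≤ ⟨Ψ, H(v) Ψ⟩` for all periodic trial states:
the pocket potential `v - t₀W` binds nothing. This is J. O. Lee, J. Stat. Phys. 134 (2009)
= arXiv:0803.0533, Thm. 7, with `V₁ = ṽ`, `V₂ = t₁W̃`; its proof is assembled from three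
Literature files written for this stub:

* `LeeNoBindingCell.lean` — Lee's Lemma 9 on a Neumann cube: the two-body floor
  `E(2, Λ_ℓ, v) ≥ e > 0` uniformly for `ℓ ∈ [ℓ₁, 2ℓ₁]` (by the Neumann gap of the cube instead
  of Dyson's lemma) and the cube domination `δt₁ ∫(∑W)|φ|² ≤ ∫(|∇φ|² + ∑v|φ|²)`,
  `δ = min ½ (e/6B)`, from stability + superadditivity;
* `LeeNoBindingCellFibre.lean` — the cell method, form version: the same inequality for the
  same-cube pairs of an `N`-body `ψ` on the grid `Λ_{Mℓ}` of Neumann cubes;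
* `LeeNoBindingTorus.lean` — the torus step: `W^per ≤` the sum over the `8` half-mesh shifted
  grids of the same-cube `W`-pair sums (covering lemma, nearest image for `L ≥ 4R₀`), each
  bounded by the periodic energy of the correspondingly translated state.

Constants: `ℓ₁ = max (4R₀) (r₁/2)` (`r₁` the core radius), `L₀ = 2ℓ₁` (so that
`M = ⌊L/ℓ₁⌋ ≥ 1` and `ℓ = L/M ∈ [ℓ₁, 2ℓ₁]`), `t₀ = δt₁/8` with `B` replaced by `max B 1`.
-/

noncomputable section

namespace Summit.AtomisticToContinuum.BoseEinsteinCondensation.Theorems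

open MeasureTheory Filter
open scoped ENNReal NNReal BigOperators
open Literature.MathematicalPhysics.QuantumManyBody.BoseGas
open Summit.AtomisticToContinuum.BoseEinsteinCondensation.Theses.BECConjugateDomination

namespace NoBindingOfStability

/-- **The Puff weight profile is admissible.** For `ṽ(x) = v(|x|)` of class `C²` with
`v(r) = 0` for `r > R₀`, the profile `W(r) = r²‖D²ṽ(r e₀)‖` (read in `ℝ≥0∞`) is measurable
and vanishes for `r > R₀` (`ṽ` vanishes on the open set `{|y| > R₀}`, hence so does `D²ṽ`).
[folklore] -/
theorem weight_measurable_and_range (v : ℝ → ℝ≥0∞)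
    (hC2 : ContDiff ℝ 2 (fun x : Space => (v ‖x‖).toReal)) (R₀ : ℝ)
    (hrange : ∀ r, R₀ < r → v r = 0) :
    Measurable (fun r : ℝ => ENNReal.ofReal (r ^ 2 *
        ‖iteratedFDeriv ℝ 2 (fun x : Space => (v ‖x‖).toReal)
          (r • EuclideanSpace.single (0 : Fin 3) (1 : ℝ))‖)) ∧
      ∀ r, R₀ < r → ENNReal.ofReal (r ^ 2 *
        ‖iteratedFDeriv ℝ 2 (fun x : Space => (v ‖x‖).toReal)
          (r • EuclideanSpace.single (0 : Fin 3) (1 : ℝ))‖) = 0 := by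
  set vt : Space → ℝ := fun x => (v ‖x‖).toReal with hvt
  set e₀ : Space := EuclideanSpace.single (0 : Fin 3) (1 : ℝ) with he₀
  have hnorm : ∀ r : ℝ, ‖r • e₀‖ = |r| := fun r => by
    rw [norm_smul, he₀, PiLp.norm_single, norm_one, mul_one, Real.norm_eq_abs]
  constructor
  · refine ENNReal.measurable_ofReal.comp (Continuous.measurable ?_)
    refine (continuous_id.pow 2).mul (Continuous.norm ?_)
    exact (hC2.continuous_iteratedFDeriv le_rfl).comp (continuous_id.smul continuous_const)
  · intro r hr
    have hopen : IsOpen {y : Space | R₀ < ‖y‖} := isOpen_lt continuous_const continuous_norm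
    have hmem : r • e₀ ∈ {y : Space | R₀ < ‖y‖} := by
      show R₀ < ‖r • e₀‖
      rw [hnorm]
      exact hr.trans_le (le_abs_self r)
    have hev : vt =ᶠ[nhds (r • e₀)] fun _ => (0 : ℝ) :=
      Filter.eventually_of_mem (hopen.mem_nhds hmem) fun y hy => by
        show (v ‖y‖).toReal = 0
        rw [hrange _ hy, ENNReal.toReal_zero]
    have hD0 : iteratedFDeriv ℝ 2 vt (r • e₀) = 0 := by
      rw [(hev.iteratedFDeriv ℝ 2).eq_of_nhds, iteratedFDeriv_fun_zero]
      rfl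
    rw [hD0, norm_zero, mul_zero, ENNReal.ofReal_zero]

/-- **The positive core.** If `ṽ(x) = v(|x|)` is continuous (here `C²`), finite, and
`v(0) > 0`, then `v ≥ v₀ > 0` on `[0, r₁)` for some `r₁ > 0` (continuity at the origin along
the ray `r e₀`), with `v₀ = v(0)/2`. [folklore] -/
theorem exists_core (v : ℝ → ℝ≥0∞) (hfin : ∀ r, v r ≠ ⊤)
    (hC2 : ContDiff ℝ 2 (fun x : Space => (v ‖x‖).toReal)) (hcore : 0 < v 0) :
    ∃ r₁ v₀ : ℝ, 0 < r₁ ∧ 0 < v₀ ∧ ∀ r, 0 ≤ r → r < r₁ → ENNReal.ofReal v₀ ≤ v r := by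
  set vt : Space → ℝ := fun x => (v ‖x‖).toReal with hvt
  set e₀ : Space := EuclideanSpace.single (0 : Fin 3) (1 : ℝ) with he₀
  have hnorm : ∀ r : ℝ, ‖r • e₀‖ = |r| := fun r => by
    rw [norm_smul, he₀, PiLp.norm_single, norm_one, mul_one, Real.norm_eq_abs]
  have hcont : Continuous fun r : ℝ => vt (r • e₀) :=
    hC2.continuous.comp (continuous_id.smul continuous_const)
  have hv0 : 0 < (v 0).toReal := ENNReal.toReal_pos hcore.ne' (hfin 0)
  obtain ⟨δ, hδ, hδ'⟩ := Metric.continuous_iff.1 hcont 0 ((v 0).toReal / 2) (by positivity)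
  refine ⟨δ, (v 0).toReal / 2, hδ, by positivity, fun r hr0 hr => ?_⟩
  have h := hδ' r (by rwa [Real.dist_eq, sub_zero, abs_of_nonneg hr0])
  have h1 : vt (r • e₀) = (v r).toReal := by
    simp only [hvt]
    rw [hnorm, abs_of_nonneg hr0]
  have h0 : vt ((0 : ℝ) • e₀) = (v 0).toReal := by
    simp only [hvt]
    rw [zero_smul, norm_zero]
  rw [h1, h0, Real.dist_eq] at h
  have h2 := (abs_lt.1 h).1
  rw [← ENNReal.ofReal_toReal (hfin r)]
  exact ENNReal.ofReal_le_ofReal (by linarith)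

/-- The side `L ≥ 2ℓ₁` of the torus is an integer multiple `L = Mℓ` of a mesh
`ℓ ∈ [ℓ₁, 2ℓ₁]`, `M = ⌊L/ℓ₁⌋ ≥ 1`. [folklore] -/
theorem exists_mesh {ℓ₁ L : ℝ} (hℓ₁ : 0 < ℓ₁) (hL : 2 * ℓ₁ ≤ L) :
    ∃ M : ℕ, ∃ ℓ : ℝ, 0 < M ∧ ℓ₁ ≤ ℓ ∧ ℓ ≤ 2 * ℓ₁ ∧ L = M * ℓ := by
  set M := ⌊L / ℓ₁⌋₊ with hM_def
  have hLpos : 0 < L := by linarith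
  have hq : (2 : ℝ) ≤ L / ℓ₁ := by rw [le_div_iff₀ hℓ₁]; linarith
  have hM1 : (M : ℝ) ≤ L / ℓ₁ := Nat.floor_le (by positivity)
  have hM2 : L / ℓ₁ < M + 1 := Nat.lt_floor_add_one _
  have hM2' : 2 ≤ M := Nat.le_floor (by exact_mod_cast hq)
  have hMpos : 0 < M := by omega
  have hMr : (0 : ℝ) < M := by exact_mod_cast hMpos
  have hMr2 : (2 : ℝ) ≤ M := by exact_mod_cast hM2'
  refine ⟨M, L / M, hMpos, ?_, ?_, ?_⟩
  · rw [le_div_iff₀ hMr]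
    rw [le_div_iff₀ hℓ₁] at hM1
    linarith
  · rw [div_le_iff₀ hMr]
    rw [div_lt_iff₀ hℓ₁] at hM2
    nlinarith
  · field_simp

end NoBindingOfStability

open NoBindingOfStability in
/-- **S2 `stub_noBindingOfStability` — no binding from classical stability (Lee 2009,
Thm. 7).** For a smooth-class `v` (repulsive finite range, finite, `C²` as `ṽ(x) = v(|x|)`,
edge condition) with positive soft core `v(0) > 0` and range `R₀`, and the Puff weight profile
`W(r) = r²‖D²ṽ(r e₀)‖`: if `v - t₁W` is classically stable with constant `B·N` on every
configuration of `ℝ³`, then there are `t₀ > 0`, `L₀ > 0` such that for every particle number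
`N`, every torus side `L ≥ L₀` and every periodic trial state `Ψ`,
`t₀ ∫_{[0,L)^{3N}} (∑_{i<j} W^per(xᵢ-xⱼ)) |Ψ|² ≤ periodicEnergy v Ψ`, i.e.
`H(v) - t₀ ∑W^per ≥ 0` as forms. Proof: the core `v ≥ v₀ > 0` on `[0,r₁)` (continuity of `ṽ`
at `0`, `exists_core`); `ℓ₁ = max (4R₀) (r₁/2)`; the two-body floor
`E(2, Λ_ℓ, v) ≥ e` for `ℓ ∈ [ℓ₁, 2ℓ₁]` and Lee's Lemma 9 on every Neumann cube
(`exists_le_neumannGroundStateEnergy_two`, `cube_domination`, with `B' = max B 1`,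
`δ = min ½ (e/6B')`); the cell method in form version on the grid `L = Mℓ`, `M = ⌊L/ℓ₁⌋`
(`setLIntegral_sameCell_le_boxN`); and the torus step over the `8` half-mesh shifted grids
(`torus_domination_of_grid`), giving `δt₁ ∫(∑W^per)|Ψ|² ≤ 8 periodicEnergy v Ψ`; so
`t₀ = δt₁/8`, `L₀ = 2ℓ₁`. Sources: J. O. Lee, J. Stat. Phys. 134 (2009) 1–18
= arXiv:0803.0533, Thm. 7, Lemmas 9 and 11 (pp. 5–7); LSSY (2005) (2.52)–(2.53). -/
theorem stub_noBindingOfStability :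
    ∀ v : ℝ → ℝ≥0∞, IsRepulsiveFiniteRange v → (∀ r, v r ≠ ⊤) →
      ContDiff ℝ 2 (fun x : Space => (v ‖x‖).toReal) →
      (∃ Cₑ : ℝ, ∀ x : Space, ‖iteratedFDeriv ℝ 2 (fun x : Space => (v ‖x‖).toReal) x‖
          ≤ Cₑ * Real.sqrt ((v ‖x‖).toReal)) →
      0 < v 0 → ∀ R₀ : ℝ, 0 < R₀ → (∀ r, R₀ < r → v r = 0) →
      ∀ t₁ B : ℝ, 0 < t₁ →
        (∀ N : ℕ, ∀ X : Config N,
          ENNReal.ofReal t₁ *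
              interaction (fun r : ℝ => ENNReal.ofReal (r ^ 2 *
                ‖iteratedFDeriv ℝ 2 (fun x : Space => (v ‖x‖).toReal)
                  (r • EuclideanSpace.single (0 : Fin 3) (1 : ℝ))‖)) X
            ≤ interaction v X + ENNReal.ofReal (B * N)) →
        ∃ t₀ L₀ : ℝ, 0 < t₀ ∧ 0 < L₀ ∧ ∀ N : ℕ, ∀ L : ℝ, L₀ ≤ L → ∀ Ψ : PeriodicTrialState N L,
          ENNReal.ofReal t₀ *
              (∫⁻ X in cellN N L,
                periodicInteraction (fun r : ℝ => ENNReal.ofReal (r ^ 2 *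
                  ‖iteratedFDeriv ℝ 2 (fun x : Space => (v ‖x‖).toReal)
                    (r • EuclideanSpace.single (0 : Fin 3) (1 : ℝ))‖)) L X *
                  (‖Ψ.ψ X‖₊ : ℝ≥0∞) ^ 2)
            ≤ periodicEnergy v Ψ := by
  intro v hv hfin hC2 _hedge hcore R₀ hR₀ hrange t₁ B ht₁ hstab
  set W : ℝ → ℝ≥0∞ := fun r : ℝ => ENNReal.ofReal (r ^ 2 *
    ‖iteratedFDeriv ℝ 2 (fun x : Space => (v ‖x‖).toReal)
      (r • EuclideanSpace.single (0 : Fin 3) (1 : ℝ))‖) with hW_def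
  obtain ⟨hWm, hWR⟩ := weight_measurable_and_range v hC2 R₀ hrange
  have hvm : Measurable v := hv.1
  -- the positive core
  obtain ⟨r₁, v₀, hr₁, hv₀, hcore'⟩ := exists_core v hfin hC2 hcore
  -- the mesh scale and the two-body floor
  set ℓ₁ := max (4 * R₀) (r₁ / 2) with hℓ₁_def
  have hℓ₁pos : 0 < ℓ₁ := lt_max_of_lt_left (by positivity)
  have hℓ₁R : 4 * R₀ ≤ ℓ₁ := le_max_left _ _
  have hℓ₁r : r₁ / 2 ≤ ℓ₁ := le_max_right _ _
  obtain ⟨e, he, hfloor⟩ := exists_le_neumannGroundStateEnergy_two (v := v) hv₀ hr₁ hcore' hℓ₁r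
  -- stability with a positive constant
  set B' := max B 1 with hB'_def
  have hB' : 0 < B' := lt_max_of_lt_right one_pos
  have hstab' : ∀ (n : ℕ) (X : Config n),
      ENNReal.ofReal t₁ * interaction W X ≤ interaction v X + ENNReal.ofReal (B' * n) :=
    fun n X => (hstab n X).trans (add_le_add le_rfl (ENNReal.ofReal_le_ofReal
      (mul_le_mul_of_nonneg_right (le_max_left _ _) (Nat.cast_nonneg n))))
  set δ := min (1 / 2) (e / (6 * B')) with hδ_def
  have hδ : 0 < δ := lt_min (by norm_num) (by positivity)
  refine ⟨δ * t₁ / 8, 2 * ℓ₁, by positivity, by positivity, fun N L hL Ψ => ?_⟩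
  -- the grid
  obtain ⟨M, ℓ, hM, hℓ1, hℓ2, hLℓ⟩ := exists_mesh hℓ₁pos hL
  have hℓpos : 0 < ℓ := hℓ₁pos.trans_le hℓ1
  have hRℓ : 4 * R₀ ≤ ℓ := hℓ₁R.trans hℓ1
  -- Lee's Lemma 9 on every Neumann cube of side `ℓ`
  have hbox : ∀ (n : ℕ) (φ : Config n → ℂ), ContDiff ℝ 1 φ →
      ENNReal.ofReal (δ * t₁) * ∫⁻ Y in boxN n ℓ, interaction W Y * (‖φ Y‖₊ : ℝ≥0∞) ^ 2 ≤
        ∫⁻ Y in boxN n ℓ, kineticDensity φ Y + interaction v Y * (‖φ Y‖₊ : ℝ≥0∞) ^ 2 :=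
    fun n φ hφ => cube_domination hvm hℓpos he hB' (hfloor ℓ hℓ1 hℓ2) hstab' n φ hφ
  -- the cell method, form version, on the big cube `Λ_L^N`
  have hgrid : ∀ Φ : PeriodicTrialState N L,
      ENNReal.ofReal (δ * t₁) * ∫⁻ X in boxN N L, (∑ i : Fin N, ∑ j : Fin N with i < j,
          if (∀ k : Fin 3, ⌊X i k / ℓ⌋ = ⌊X j k / ℓ⌋) then W (dist (X i) (X j)) else 0) *
            (‖Φ.ψ X‖₊ : ℝ≥0∞) ^ 2 ≤
        ∫⁻ X in boxN N L, kineticDensity Φ.ψ X + interaction v X * (‖Φ.ψ X‖₊ : ℝ≥0∞) ^ 2 := by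
    intro Φ
    have h := setLIntegral_sameCell_le_boxN (N := N) hM hℓpos hvm hWm Φ.contDiff hbox
    rwa [← hLℓ] at h
  -- the torus step
  have htorus := torus_domination_of_grid hM hℓpos hLℓ hWm hWR hRℓ hgrid Ψ
  -- divide by eight
  have h8 : ENNReal.ofReal (δ * t₁ / 8) = ENNReal.ofReal (δ * t₁) / 8 := by
    rw [ENNReal.ofReal_div_of_pos (by norm_num : (0 : ℝ) < 8), ENNReal.ofReal_ofNat]
  rw [h8, div_eq_mul_inv, mul_right_comm, ← div_eq_mul_inv]
  exact ENNReal.div_le_of_le_mul (htorus.trans_eq (mul_comm _ _))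

end Summit.AtomisticToContinuum.BoseEinsteinCondensation.Theorems
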